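import Mathlib.Analysis.Calculus.DerivativeTest
import Mathlib.Analysis.Calculus.Deriv.Add
import Mathlib.Analysis.Calculus.Deriv.Pow
import Mathlib.Analysis.Calculus.LocalExtr.Basic
import Mathlib.Topology.Order.Compact
import Mathlib.Algebra.BigOperators.Group.Finset.Basic
import HarnessLib

/-!
# The port-cube maximum principle with first-order information (minimal-counterexample form)

Support file for crux `stmt-CriticalPhenomena-4575` (`NoHeavyLowerTail`), seat `prim-l12-p1` gen 26 (`--supports stmt-CriticalPhenomena-4575`);
memo `run/shared/lean/prim/prim-l12/FROM-prim-l12-p1-g26-THEOREM-R-KERNEL.md` §6.  Pure real analysis (Mathlib only); no definitions, no sorries.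
Sharpening of gen 25's `PortCubeMaxPrinciple.cube_maximum_principle`: there, a convex coordinate direction was required at EVERY interior point of
the cube.  At an interior maximum `x` of the perturbed function `f + ε·Σ xᵢ²` one knows more: `f(x) > 0` may be assumed (otherwise the bound is
trivial) and every coordinate line has derivative `∂ᵢ f(x) = −2ε xᵢ ≤ 0`.  So it suffices to have a convex direction at the interior points where
`f > 0` and all first partial derivatives are `≤ 0` ("critical violating points"):

* `cube_maximum_principle_critical` — `f` continuous on `[0,1]^k`, `≤ 0` on the boundary, differentiable along every coordinate line at every
  interior point (derivative `D1 i x` supplied by the user), and at every interior `x` with `f x > 0` and `∀ i, D1 i x ≤ 0` some coordinate line has a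
  derivative function near `xᵢ` that is differentiable at `xᵢ` with derivative `≥ 0`.  Then `f ≤ 0` on the cube.
For the super-terminal quartic law this turns THEOREM R (`(MAXDIR) ⟹ V4`) into a characterisation: `V4` holds on every finite weighted graph iff no
port cube carries an interior critical point of `Φ₄ − I'_c` with `Φ₄ > I'_c` at which every cube direction is concave (`…SuperTerminalQuarticOfCritical`).
-/

namespace Summit.CriticalPhenomena.PercolationContinuityZ3.Theorems.PortCubeMaxPrincipleCritical

open Filter Topology Set

variable {k : ℕ}

/-- **The cube maximum principle, critical-point form.**  Let `f` be continuous on the closed cube `[0,1]^k` and `≤ 0` on its boundary; suppose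
that at every interior point `x` every coordinate line `s ↦ f(x with xᵢ := s)` has a derivative `D1 i x` at `xᵢ`, and that at every interior `x`
with `f x > 0` and `D1 i x ≤ 0` for ALL `i`, SOME coordinate line admits a derivative function near `xᵢ` which is differentiable at `xᵢ` with
derivative `D ≥ 0`.  Then `f ≤ 0` on the whole cube.  (At an interior maximiser of `f + ε·Σxᵢ²` with `f > 0`, every line derivative of `f` equals
`−2ε xᵢ < 0`, and the convex line would have second derivative `D + 2ε > 0` — impossible at a maximum; so the maximum is on the boundary or at a
point with `f ≤ 0`, whence `f ≤ kε`; let `ε → 0`.) [this work] -/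
theorem cube_maximum_principle_critical (f : (Fin k → ℝ) → ℝ) (hcont : ContinuousOn f (Icc (0 : Fin k → ℝ) 1))
    (hbdry : ∀ x ∈ Icc (0 : Fin k → ℝ) 1, (∃ i, x i = 0 ∨ x i = 1) → f x ≤ 0)
    (D1 : Fin k → (Fin k → ℝ) → ℝ)
    (hderiv : ∀ x : Fin k → ℝ, (∀ i, 0 < x i ∧ x i < 1) → ∀ i, HasDerivAt (fun s => f (Function.update x i s)) (D1 i x) (x i))
    (hdir : ∀ x : Fin k → ℝ, (∀ i, 0 < x i ∧ x i < 1) → 0 < f x → (∀ i, D1 i x ≤ 0) →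
      ∃ i : Fin k, ∃ g' : ℝ → ℝ, ∃ D : ℝ, 0 ≤ D ∧
        (∀ᶠ s in 𝓝 (x i), HasDerivAt (fun s => f (Function.update x i s)) (g' s) s) ∧ HasDerivAt g' D (x i)) :
    ∀ x ∈ Icc (0 : Fin k → ℝ) 1, f x ≤ 0 := by
  -- second-derivative test, contrapositive form (as `PortCubeMaxPrinciple.not_isLocalMax_of_hasDerivAt_deriv_pos`, whose olean is not yet
  -- available on the farm; restated locally): a derivative function `G'` near `t` with `G''(t) > 0` excludes a local maximum at `t`
  have no_locmax : ∀ {G G' : ℝ → ℝ} {t D : ℝ}, (∀ᶠ s in 𝓝 t, HasDerivAt G (G' s) s) → HasDerivAt G' D t → 0 < D → ¬ IsLocalMax G t := by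
    intro G G' t D hg hD hpos hmax
    have hderiv : deriv G =ᶠ[𝓝 t] G' := hg.mono fun s hs => hs.deriv
    have hdd : deriv (deriv G) t = D := by rw [hderiv.deriv_eq]; exact hD.deriv
    have hcont : ContinuousAt G t := (hg.self_of_nhds).continuousAt
    have hzero : deriv G t = 0 := hmax.deriv_eq_zero
    have hmin : IsLocalMin G t := isLocalMin_of_deriv_deriv_pos (by rw [hdd]; exact hpos) hzero hcont
    have hconst : ∀ᶠ s in 𝓝 t, G s = G t := by
      filter_upwards [hmax, hmin] with s h1 h2 using le_antisymm h1 h2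
    have hderiv0 : deriv G =ᶠ[𝓝 t] fun _ => 0 := by
      filter_upwards [hconst.eventually_nhds] with s hs
      have hloc : G =ᶠ[𝓝 s] fun _ => G t := hs
      rw [hloc.deriv_eq]
      exact deriv_const s (G t)
    have : deriv (deriv G) t = 0 := by
      rw [hderiv0.deriv_eq]; exact deriv_const t (0 : ℝ)
    rw [hdd] at this
    exact absurd this hpos.ne'
  -- auxiliary facts about the cube and the perturbation (as in `PortCubeMaxPrinciple`)
  have update_mem : ∀ {x : Fin k → ℝ}, x ∈ Icc (0 : Fin k → ℝ) 1 → ∀ (i : Fin k) {s : ℝ}, s ∈ Icc (0 : ℝ) 1 →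
      Function.update x i s ∈ Icc (0 : Fin k → ℝ) 1 := by
    intro x hx i s hs
    refine ⟨fun j => ?_, fun j => ?_⟩
    · rcases eq_or_ne j i with rfl | hne
      · simp [hs.1]
      · rw [Function.update_of_ne hne]; exact hx.1 j
    · rcases eq_or_ne j i with rfl | hne
      · simp [hs.2]
      · rw [Function.update_of_ne hne]; exact hx.2 j
  have sum_sq_le : ∀ {x : Fin k → ℝ}, x ∈ Icc (0 : Fin k → ℝ) 1 → ∑ i, x i ^ 2 ≤ (k : ℝ) := by
    intro x hx
    calc ∑ i, x i ^ 2 ≤ ∑ _i : Fin k, (1 : ℝ) := by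
          refine Finset.sum_le_sum fun i _ => ?_
          have h0 := hx.1 i; have h1 := hx.2 i
          simp only [Pi.zero_apply, Pi.one_apply] at h0 h1
          nlinarith
      _ = (k : ℝ) := by simp
  have perturb : ∀ (x : Fin k → ℝ) (i : Fin k) (ε s : ℝ),
      HasDerivAt (fun s => ε * ∑ j, (Function.update x i s j) ^ 2) (ε * (2 * s)) s := by
    intro x i ε s
    have hsum : HasDerivAt (fun s => ∑ j, (Function.update x i s j) ^ 2) (∑ j : Fin k, if j = i then 2 * s else 0) s := by
      refine HasDerivAt.fun_sum fun j _ => ?_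
      rcases eq_or_ne j i with rfl | hne
      · simp only [Function.update_self, if_true]
        simpa using (hasDerivAt_pow 2 s)
      · simp only [Function.update_of_ne hne, hne, if_false]
        exact hasDerivAt_const s _
    have : (∑ j : Fin k, if j = i then 2 * s else 0) = 2 * s := by simp
    rw [this] at hsum
    exact hsum.const_mul ε
  -- Step 1: for every ε > 0, `f ≤ k ε` on the cube.
  have step : ∀ ε : ℝ, 0 < ε → ∀ x ∈ Icc (0 : Fin k → ℝ) 1, f x ≤ (k : ℝ) * ε := by
    intro ε hε
    set F : (Fin k → ℝ) → ℝ := fun x => f x + ε * ∑ i, x i ^ 2 with hF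
    have hFcont : ContinuousOn F (Icc (0 : Fin k → ℝ) 1) := by
      refine hcont.add (Continuous.continuousOn ?_)
      exact continuous_const.mul (continuous_finsetSum _ fun i _ => (continuous_apply i).pow 2)
    have hne : (Icc (0 : Fin k → ℝ) 1).Nonempty := ⟨0, ⟨le_rfl, zero_le_one⟩⟩
    obtain ⟨xs, hxs, hmax⟩ := (isCompact_Icc : IsCompact (Icc (0 : Fin k → ℝ) 1)).exists_isMaxOn hne hFcont
    have hbound : ∀ x ∈ Icc (0 : Fin k → ℝ) 1, f x ≤ f xs + ε * (k : ℝ) := by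
      intro x hx
      have h1 : F x ≤ F xs := hmax hx
      have h3 : ε * ∑ i, xs i ^ 2 ≤ ε * k := mul_le_mul_of_nonneg_left (sum_sq_le hxs) hε.le
      have h4 : 0 ≤ ε * ∑ i, x i ^ 2 := mul_nonneg hε.le (Finset.sum_nonneg fun i _ => sq_nonneg _)
      have h5 : f x ≤ F x := by simp only [hF]; linarith
      have h6 : F xs = f xs + ε * ∑ i, xs i ^ 2 := rfl
      linarith
    -- it suffices that `f xs ≤ 0`
    suffices hfxs : f xs ≤ 0 by
      intro x hx; have := hbound x hx; linarith
    by_cases hb : ∃ i, xs i = 0 ∨ xs i = 1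
    · exact hbdry xs hxs hb
    by_contra hpos
    push Not at hpos
    have hint' : ∀ i, 0 < xs i ∧ xs i < 1 := fun i => by
      have hi : ¬ (xs i = 0 ∨ xs i = 1) := fun h => hb ⟨i, h⟩
      exact ⟨lt_of_le_of_ne (hxs.1 i) (fun h => hi (Or.inl h.symm)), lt_of_le_of_ne (hxs.2 i) (fun h => hi (Or.inr h))⟩
    -- every coordinate line of `F` has a local maximum at `xs i`
    have hlocmax : ∀ i, IsLocalMax (fun s => F (Function.update xs i s)) (xs i) := by
      intro i
      have hnhd : Ioo (0 : ℝ) 1 ∈ 𝓝 (xs i) := Ioo_mem_nhds (hint' i).1 (hint' i).2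
      filter_upwards [hnhd] with s hs
      have hmem : Function.update xs i s ∈ Icc (0 : Fin k → ℝ) 1 := update_mem hxs i ⟨hs.1.le, hs.2.le⟩
      have := hmax hmem
      simpa [Function.update_eq_self] using this
    -- first-order information: `D1 i xs = -2 ε xs_i < 0`
    have hD1 : ∀ i, D1 i xs ≤ 0 := by
      intro i
      have hline : HasDerivAt (fun s => F (Function.update xs i s)) (D1 i xs + ε * (2 * xs i)) (xs i) :=
        (hderiv xs hint' i).add (perturb xs i ε (xs i))
      have h0 : D1 i xs + ε * (2 * xs i) = 0 := (hlocmax i).hasDerivAt_eq_zero hline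
      nlinarith [(hint' i).1]
    obtain ⟨i, g', D, hD0, hg, hgD⟩ := hdir xs hint' hpos hD1
    have hline : ∀ᶠ s in 𝓝 (xs i), HasDerivAt (fun s => F (Function.update xs i s)) (g' s + ε * (2 * s)) s := by
      filter_upwards [hg] with s hs using hs.add (perturb xs i ε s)
    have hD : HasDerivAt (fun s => g' s + ε * (2 * s)) (D + ε * 2) (xs i) := by
      have h2 : HasDerivAt (fun s : ℝ => ε * (2 * s)) (ε * 2) (xs i) := by
        simpa using ((hasDerivAt_id (xs i)).const_mul 2).const_mul ε
      exact hgD.add h2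
    have hpos' : 0 < D + ε * 2 := by positivity
    exact no_locmax hline hD hpos' (hlocmax i)
  -- Step 2: let ε → 0.
  intro x hx
  refine le_of_forall_pos_le_add fun ε hε => ?_
  have := step (ε / ((k : ℝ) + 1)) (by positivity) x hx
  have hk : (k : ℝ) * (ε / ((k : ℝ) + 1)) ≤ ε := by
    rw [mul_div_assoc', div_le_iff₀ (by positivity)]
    nlinarith
  linarith

end Summit.CriticalPhenomena.PercolationContinuityZ3.Theorems.PortCubeMaxPrincipleCritical
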